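import Literature.NumberTheory.GelbartRogawski1991.LocalKudlaSplittingInjective
import Literature.NumberTheory.GelbartRogawski1991.LocalLineModelTransport
import Literature.NumberTheory.GelbartRogawski1991.LocalUnitarySplittingsCMExplicit
import Literature.NumberTheory.GelbartRogawski1991.UndoublingPlaceAssembly
import Literature.NumberTheory.Automorphic.Liu2021.LemD1AsPrintedIndexedNonVacuityAtPlace
import HarnessLib

/-!
# Kudla's local injectivity `s_{μ_v} = s_{μ'_v} ⇒ μ_v = μ'_v`, read on the packages of record

[Kudla1994, §3 Thm. 3.1] / [GelbartRogawski1991, §3.1 Prop. 3.1.1]: at a finite place `v` of `L⁺` inert or ramified in the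
CM field `L`, the splitting `s_{μ_v} : U(V)(L⁺_v) → Mp(𝕎_v)` attached to a splitting character `μ` DETERMINES `μ_v`.
The kernel statement for the tree's CM local splitting `localSplittingCM` in rank `3` is
`localMu_eq_of_localSplittingCM_eq` (`LocalKudlaSplittingInjective.lean`).  This file transports it to the two currencies
in which the consumers ([Liu2021, App. D Lem. D.1 (3)], line `a4-liuD3`) meet these splittings:

* §1 `lineTransportSection_injective`: B-typ01/B-p13's line-model transport `s′ ↦ lineTransportSection … a v s′` of
  [MoeglinVignerasWaldspurger1987, Chap. 2 II.1] (`LocalLineModelTransport.lean`) is INJECTIVE in the section `s′` (its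
  operators are those of `s′` on `U(J_V) ⊗ 1`, `toOp_lineTransportSection`, its projections are prescribed, and
  `g ↦ g ⊗ 1` is onto the pair group of a line, `localLineInl_surjective`).
* §2 `gramR_eq_diagonal`: the rational Gram matrix `gramR = reindex e e (diag dV ⊗ diag dW)` of the package of record is
  diagonal (plumbing for the diagonal hypothesis of `localMu_eq_of_localSplittingCM_eq`).
* §3 `localMu_eq_of_congrW_undoubledSplittings_s_eq`: if the undoubled explicit CM packages of record of two splitting
  characters `χ, χ'` (`congrW hT hJ (undoubledSplittings … χ 𝔪₀ (cmFinLocalFamily … χ …))`, `UndoublingPlaceAssembly.lean`,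
  `LocalUnitarySplittingsCMExplicit.lean`), transported to any W-side Gram data, have the same member at a place `v` with
  `L ⊗ L⁺_v` a field, then `localMu χ v = localMu χ' v` (rank `3`).

## References
* [Kudla1994] S. Kudla, *Splitting metaplectic covers of dual reductive pairs*, Israel J. Math. 87 (1994), §3 Thm. 3.1.
* [GelbartRogawski1991] S. Gelbart, J. Rogawski, *L-functions and Fourier–Jacobi coefficients for the unitary group U(3)*,
  Invent. Math. 105 (1991), §3.1 Prop. 3.1.1 p. 455.
* [MoeglinVignerasWaldspurger1987] C. Mœglin, M.-F. Vignéras, J.-L. Waldspurger, LNM 1291, Chap. 2 II.1.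
-/

set_option autoImplicit false

noncomputable section

open scoped Matrix Kronecker
open NumberField IsDedekindDomain MeasureTheory
open Literature.RepresentationTheory.HeisenbergGroup
open Literature.NumberTheory.Automorphic Literature.NumberTheory.Automorphic.UnitaryGroup Literature.NumberTheory.Weil1964
open Literature.RepresentationTheory.HarrisKudlaSweet1996 Literature.NumberTheory.GaloisRepresentations
open Literature.NumberTheory.Automorphic.Liu2021.Def411WeilCarriers (TW JW JW_eq isSymm_TW JW_apply_ne_zero)

/-! ## §1 The line-model transport is injective in the section -/

namespace Literature.NumberTheory.GelbartRogawski1991.UnitaryDualPair.LocalSplitting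

/-- **`s′ ↦ lineTransportSection … a v s′` is injective**: two sections `s′₁, s′₂` of the pair model `(a•T_V, δ)` over
`ι_δ` with the same transported section `U(J_V)(F_v) →* S̃p_ψ(𝕎_v, β_{T_V})` are equal — the transported section keeps the
operator of `s′(g ⊗ 1)` (`toOp_lineTransportSection`), the symplectic components are prescribed (`hs′`), and `g ↦ g ⊗ 1` is
onto `U(J_V ⊗ (a))(F_v)` for a line (`localLineInl_surjective`).
[cite: MoeglinVignerasWaldspurger1987, Chap. 2 II.1 (A); Chap. 3 I.1] -/
theorem lineTransportSection_injective (F E : Type) [Field F] [NumberField F] [Field E] [NumberField E] [Algebra F E]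
    [Algebra.IsQuadraticExtension F E] (c : E ≃ₐ[F] E) (N : ℕ) {δ : E} (hcδ : c δ = -δ) (hδ : δ ≠ 0) {d : F}
    (hd : δ * δ = algebraMap F E d) (TV : Matrix (Fin N) (Fin N) F) (hV : TV.IsSymm) (JV : Matrix (Fin N) (Fin N) E)
    (hJV : JV = TV.map (algebraMap F E)) (a : Fˣ) (v : HeightOneSpectrum (𝓞 F))
    (s₁ s₂ : localPi E c N (Matrix.reindex (Equiv.prodUnique (Fin N) (Fin 1)) (Equiv.prodUnique (Fin N) (Fin 1))
        (JV ⊗ₖ JW F E a)) v →* LocalMp F N (gram F (Equiv.prodUnique (Fin N) (Fin 1)) TV (TW F a)) v)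
    (hs₁ : ∀ g, MpPsi.proj _ (s₁ g) = iota F E c N hcδ hδ hd (gram F (Equiv.prodUnique (Fin N) (Fin 1)) TV (TW F a))
      (isSymm_gram F (Equiv.prodUnique (Fin N) (Fin 1)) hV (isSymm_TW F a))
      (reindex_kronecker_eq_gram_map F E (Equiv.prodUnique (Fin N) (Fin 1)) hJV (JW_eq F E a)) v g)
    (hs₂ : ∀ g, MpPsi.proj _ (s₂ g) = iota F E c N hcδ hδ hd (gram F (Equiv.prodUnique (Fin N) (Fin 1)) TV (TW F a))
      (isSymm_gram F (Equiv.prodUnique (Fin N) (Fin 1)) hV (isSymm_TW F a))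
      (reindex_kronecker_eq_gram_map F E (Equiv.prodUnique (Fin N) (Fin 1)) hJV (JW_eq F E a)) v g)
    (h : lineTransportSection F E c N hcδ hδ hd TV hV JV hJV a v s₁ hs₁ =
      lineTransportSection F E c N hcδ hδ hd TV hV JV hJV a v s₂ hs₂) :
    s₁ = s₂ := by
  refine MonoidHom.ext fun g' => ?_
  obtain ⟨g, rfl⟩ :=
    localLineInl_surjective E c N (Equiv.prodUnique (Fin N) (Fin 1)) JV (JW F E a) (JW_apply_ne_zero F E a) v g'
  have hop : MpPsi.toOp _ (s₁ (localLineInl E c N (Equiv.prodUnique (Fin N) (Fin 1)) JV (JW F E a) v g)) =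
      MpPsi.toOp _ (s₂ (localLineInl E c N (Equiv.prodUnique (Fin N) (Fin 1)) JV (JW F E a) v g)) := by
    rw [← toOp_lineTransportSection F E c N hcδ hδ hd TV hV JV hJV a v s₁ hs₁ g,
      ← toOp_lineTransportSection F E c N hcδ hδ hd TV hV JV hJV a v s₂ hs₂ g, h]
  have hpr : MpPsi.proj _ (s₁ (localLineInl E c N (Equiv.prodUnique (Fin N) (Fin 1)) JV (JW F E a) v g)) =
      MpPsi.proj _ (s₂ (localLineInl E c N (Equiv.prodUnique (Fin N) (Fin 1)) JV (JW F E a) v g)) :=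
    (hs₁ _).trans (hs₂ _).symm
  exact Subtype.ext (Prod.ext hpr hop)

end Literature.NumberTheory.GelbartRogawski1991.UnitaryDualPair.LocalSplitting

/-! ## §2 The rational Gram matrix of the package of record is diagonal -/

namespace Literature.NumberTheory.GelbartRogawski1991.GRConstruction

open UnitaryDualPair UnitaryDualPair.LocalSplitting

variable (L : Type) [Field L] [NumberField L] [IsCMField L]

/-- **`gramR = reindex e e (diag dV ⊗ diag dW)` is the diagonal matrix `diag (dV_{e⁻¹k.1} · dW_{e⁻¹k.2})_k`** (Kronecker
product of diagonal matrices, re-indexed along `e`). [cite: GelbartRogawski1991, §3.1 Prop. 3.1.1 p. 455 L1–2] -/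
theorem gramR_eq_diagonal {N M n : ℕ} (e : Fin N × Fin M ≃ Fin n) (dV : Fin N → L)
    (hdV : ∀ i, IsCMField.complexConj L (dV i) = dV i) (dW : Fin M → L)
    (hdW : ∀ i, IsCMField.complexConj L (dW i) = dW i) :
    gramR L e dV hdV dW hdW = Matrix.diagonal fun k =>
      (⟨dV (e.symm k).1, (IsCMField.complexConj_eq_self_iff (K := L) (dV (e.symm k).1)).1 (hdV _)⟩ : Fp L) *
        ⟨dW (e.symm k).2, (IsCMField.complexConj_eq_self_iff (K := L) (dW (e.symm k).2)).1 (hdW _)⟩ := by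
  change Matrix.reindex e e (realDiagonal L dV hdV ⊗ₖ realDiagonal L dW hdW) = _
  rw [realDiagonal, realDiagonal, Matrix.diagonal_kronecker_diagonal, Matrix.reindex_apply,
    Matrix.submatrix_diagonal_equiv]
  rfl

/-! ## §3 Kudla's injectivity on the transported undoubled CM packages of record -/

/-- **Equal members at a non-split place of the undoubled explicit CM packages of record of `χ` and `χ'` force
`μ_v(χ) = μ_v(χ')`** (rank `3`): for any W-side Gram data `T_W', J_W'` with `realDiagonal dW = T_W'`, `diag dW = J_W'`, if
`(congrW hT hJ (undoubledSplittings … χ 𝔪₀ (cmFinLocalFamily … χ hχ 𝔪₀))).s v =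
 (congrW hT hJ (undoubledSplittings … χ' 𝔪₀ (cmFinLocalFamily … χ' hχ' 𝔪₀))).s v` at a finite place `v` of `L⁺` with
`L ⊗ L⁺_v` a field, then `localMu χ v = localMu χ' v`.  Proof: strip the transport (`subst`), identify both members with
`localSplittingCM … v` (`undouble_finSplittings_cmFinLocalFamily_s`), and apply `localMu_eq_of_localSplittingCM_eq` on the
diagonal Gram matrix `gramR` (`gramR_eq_diagonal`) at the place `w ∣ v` of `L`, conjugation-fixed since `v` does not split
(`not_isField_localRing_of_split`).
[cite: Kudla1994, §3 Thm. 3.1] [cite: GelbartRogawski1991, §3.1 Prop. 3.1.1 p. 455 L1–3] -/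
theorem localMu_eq_of_congrW_undoubledSplittings_s_eq {N M : ℕ} (e : Fin N × Fin M ≃ Fin 3) (dV : Fin N → L)
    (hdV : ∀ i, IsCMField.complexConj L (dV i) = dV i) (hdV0 : ∀ i, dV i ≠ 0) (dW : Fin M → L)
    (hdW : ∀ i, IsCMField.complexConj L (dW i) = dW i) (hdW0 : ∀ i, dW i ≠ 0)
    {TW' : Matrix (Fin M) (Fin M) (Fp L)} {JW' : Matrix (Fin M) (Fin M) L} (hT : realDiagonal L dW hdW = TW')
    (hJ : Matrix.diagonal dW = JW') (hW' : TW'.IsSymm) (hJW' : JW' = TW'.map (algebraMap (Fp L) L))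
    (χ χ' : HeckeCharacter L) (hχ : IsSplittingChar L 1 χ) (hχ' : IsSplittingChar L 1 χ')
    (v : HeightOneSpectrum (𝓞 (Fp L))) (hE : IsField (LocalRing L v))
    (h : (congrW L e dV hdV dW hdW hT hJ
        (undoubledSplittings L e dV hdV hdV0 dW hdW hdW0 χ (borelPlaceMeasure L)
          (cmFinLocalFamily L e dV hdV hdV0 dW hdW hdW0 χ hχ (borelPlaceMeasure L))) hW' hJW').s v =
      (congrW L e dV hdV dW hdW hT hJ
        (undoubledSplittings L e dV hdV hdV0 dW hdW hdW0 χ' (borelPlaceMeasure L)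
          (cmFinLocalFamily L e dV hdV hdV0 dW hdW hdW0 χ' hχ' (borelPlaceMeasure L))) hW' hJW').s v) :
    localMu L χ v = localMu L χ' v := by
  subst hT hJ
  change (undoubledSplittings L e dV hdV hdV0 dW hdW hdW0 χ (borelPlaceMeasure L)
        (cmFinLocalFamily L e dV hdV hdV0 dW hdW hdW0 χ hχ (borelPlaceMeasure L))).s v =
      (undoubledSplittings L e dV hdV hdV0 dW hdW hdW0 χ' (borelPlaceMeasure L)
        (cmFinLocalFamily L e dV hdV hdV0 dW hdW hdW0 χ' hχ' (borelPlaceMeasure L))).s v at h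
  have h3 : localSplittingCM L 3 (gramR_isSymm L e dV hdV dW hdW) (isUnit_det_gramR₀ L e dV hdV hdV0 dW hdW hdW0)
        (reindex_kronecker_eq_gram_map (Fp L) L e (realDiagonal_map L dV hdV).symm (realDiagonal_map L dW hdW).symm)
        χ hχ v =
      localSplittingCM L 3 (gramR_isSymm L e dV hdV dW hdW) (isUnit_det_gramR₀ L e dV hdV hdV0 dW hdW hdW0)
        (reindex_kronecker_eq_gram_map (Fp L) L e (realDiagonal_map L dV hdV).symm (realDiagonal_map L dW hdW).symm)
        χ' hχ' v :=
    ((undouble_finSplittings_cmFinLocalFamily_s L e dV hdV hdV0 dW hdW hdW0 χ hχ _ v).symm.trans h).trans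
      (undouble_finSplittings_cmFinLocalFamily_s L e dV hdV hdV0 dW hdW hdW0 χ' hχ' _ v)
  obtain ⟨w⟩ : Nonempty (PlacesOver L v) := inferInstance
  have hw : IsCMField.complexConj L • w.1 = w.1 := by
    by_contra hne
    exact Literature.NumberTheory.Automorphic.Liu2021.LemD1IndexedNonVacuityAtPlace.not_isField_localRing_of_split L v
      (IsCMField.complexConj L) w hne hE
  exact localMu_eq_of_localSplittingCM_eq L _ (gramR_eq_diagonal L e dV hdV dW hdW) (gramR_isSymm L e dV hdV dW hdW)
    (isUnit_det_gramR₀ L e dV hdV hdV0 dW hdW hdW0) _ χ χ' hχ hχ' v w hw h3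

end Literature.NumberTheory.GelbartRogawski1991.GRConstruction

end
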